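import Literature.NumberTheory.Automorphic.UnitarySliceChart        -- ★∕⊙ (D1a): the `U`-valued slice chart (shapes of `A`, `B`, `s`, `τ`)
import HarnessLib

/-!
# The SLICE DATUM of a unitary group `U(σ, J)` at a SEMISIMPLE point, II: GROUP COORDINATES on the slice factor —
# `Y ↦ γ c(Y)` is an open embedding of the `𝔤_γ`-ball `B` onto a neighbourhood of `γ` in the centraliser group `Z_U(γ)`, with inverse `m ↦ c(γ⁻¹ m)`
# (N6nsGerm (S1)∕(S2), brick (D1), part b)

Topic `NumberTheory/Automorphic`; namespace `Literature.NumberTheory.Automorphic`. KERNEL mathematics only: theorems, no definition, no named fact, no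
instance, no notation, no `sorry`.  Cell `pub/hodgecm-mathlib` (LEAD F0P3a-plan (g9) WORD T8-38 (1), road «N6nsGerm» of A-p12 (g18), census
`CENSUS-N6nsGerm-S1.A-p16g26.md` brick (D1)).  Harish-Chandra's descent at a singular semisimple `γ` integrates over a neighbourhood of `γ` IN THE GROUP
`Z_U(γ)`; part I (★ `UnitarySliceChart`) charts `U` near `γ` by `(X, Y) ↦ c(X)·γ c(Y)·c(X)⁻¹` with `Y` in the θ-skew ball `B` of the ALGEBRA `𝔤_γ = ker ad γ`.
This file re-coordinatises the second factor by the group: `ζ : B → Z_U(γ)`, `ζ(Y) = γ c(Y)`, is an `OpenPartialHomeomorph` onto a neighbourhood of `γ`,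
because the Cayley transform is an involution (★ `cayley_cayley`): the inverse is `m ↦ c(γ⁻¹ m)`, which lands in `B` since `c(γ⁻¹ m)` commutes with `γ`
(★ `commute_cayley`) and is θ-skew for unitary `γ⁻¹ m` (§1).  The regular twin ★ `UnitaryCayleyChartDatumTorus` needed charpoly rigidity for this step;
at a singular `γ` the Cayley inverse does it directly.

* §1 `cayley_ringInverse_eq_neg` (`c(g⁻¹) = −c(g)` in any ring), **`formAdjoint_cayley_of_mem`** (`g ∈ U(σ, J)`, `1 + g` a unit ⇒ `θ_J c(g) = −c(g)`).
* §2 **`exists_openPartialHomeomorph_sliceGroupCoordinate`** — for the slice data `τ(Y) = γ c(Y)` of part I: an open `B₀ ∋ b₀` with `{a₀} × B₀ ⊆ e.source` and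
  `ζ : OpenPartialHomeomorph B ↥(Z_U(γ))` with `ζ.source = B₀` and `↑(ζ b) = τ b` — exactly the package ★ `exists_openPartialHomeomorph_torusCoordinate` delivers
  in the regular case, so the composition step of part III is the regular one verbatim.

HONEST SCOPE.  Point-set topology of matrix groups only.  HC_CM is proved only modulo the printed citations until rung 0 closes; this file discharges no printed
statement.

## References
* [Weyl1939] H. Weyl, *The Classical Groups* (1939), Ch. II §10 (Cayley parametrisation; `c` is an involution exchanging `U` and its Lie algebra).
* [HarishChandra1970] Harish-Chandra (notes by G. van Dijk), *Harmonic Analysis on Reductive p-adic Groups*, LNM 162 (1970), Part II §5.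
* [Rogawski1990] J. D. Rogawski, *Automorphic Representations of Unitary Groups in Three Variables*, Ann. of Math. Stud. 123 (1990), §8.2 Prop. 8.2.1 pp. 112–116.
-/

set_option autoImplicit false

noncomputable section

open Set Filter Topology Polynomial
open Literature.Analysis.Calculus Literature.LinearAlgebra.Matrix
open scoped Matrix.Norms.Operator Matrix MatrixGroups Pointwise

namespace Literature.NumberTheory.Automorphic

/-! ## §1 The Cayley transform of a unitary element is θ-skew -/

section CayleyInv

variable {R : Type*} [Ring R]

/-- **`c(g⁻¹) = −c(g)`** for a unit `g` with `1 + g` a unit: `c(g⁻¹)(1 + g) = c(g⁻¹)(1 + g⁻¹) g = (1 − g⁻¹) g = g − 1`. [cite: Weyl1939, Ch. II §10] -/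
theorem cayley_ringInverse_eq_neg {g : R} (hg : IsUnit g) (h1 : IsUnit (1 + g)) : cayley (Ring.inverse g) = -cayley g := by
  have hgg : Ring.inverse g * g = 1 := Ring.inverse_mul_cancel g hg
  have h1' : (1 + Ring.inverse g) * g = 1 + g := by rw [add_mul, one_mul, hgg, add_comm]
  have hfac : 1 + Ring.inverse g = Ring.inverse g * (1 + g) := by rw [mul_add, mul_one, hgg, add_comm]
  have hu : IsUnit (1 + Ring.inverse g) := by rw [hfac]; exact hg.ringInverse.mul h1
  have hc : ∀ {x : R}, IsUnit (1 + x) → cayley x * (1 + x) = 1 - x := fun {x} hx => by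
    rw [cayley_def, mul_assoc, Ring.inverse_mul_cancel _ hx, mul_one]
  have hkey : cayley (Ring.inverse g) * (1 + g) = -(1 - g) := by
    rw [← h1', ← mul_assoc, hc hu, sub_mul, one_mul, hgg, neg_sub]
  calc cayley (Ring.inverse g) = cayley (Ring.inverse g) * (1 + g) * Ring.inverse (1 + g) := (Ring.mul_inverse_cancel_right _ _ h1).symm
    _ = -cayley g := by rw [hkey, neg_mul, cayley_def]

/-- `1 + c(X) = 2(1 + X)⁻¹` is a unit when `2` and `1 + X` are (ring form of ★ `isUnit_one_add_cayley`, whose file assumes an `ℝ`-algebra). [cite: Weyl1939, Ch. II §10] -/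
theorem isUnit_one_add_cayley_of_isUnit_two {X : R} (h2 : IsUnit (2 : R)) (h : IsUnit (1 + X)) : IsUnit (1 + cayley X) := by
  rw [one_add_cayley h]
  exact h2.mul h.ringInverse

/-- **The Cayley transform is an involution**, ring form: `c(c(X)) = X` when `2` and `1 + X` are units (★ `cayley_cayley` assumes an `ℝ`-algebra; the
non-archimedean unitary groups need this version). [cite: Weyl1939, Ch. II §10] -/
theorem cayley_cayley_of_isUnit_two {X : R} (h2 : IsUnit (2 : R)) (h : IsUnit (1 + X)) : cayley (cayley X) = X := by
  obtain ⟨t, ht⟩ := h2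
  obtain ⟨u, hu⟩ := h
  have hinv1 : Ring.inverse (1 + X) = ((u⁻¹ : Rˣ) : R) := by rw [← hu, Ring.inverse_unit]
  have htX : Commute (t : R) X := by
    rw [ht, show (2 : R) = 1 + 1 from one_add_one_eq_two.symm]
    exact (Commute.one_left X).add_left (Commute.one_left X)
  rw [cayley_def, one_sub_cayley ⟨u, hu⟩, one_add_cayley ⟨u, hu⟩, hinv1, ← ht, ← Units.val_mul, Ring.inverse_unit, mul_inv_rev, inv_inv,
    Units.val_mul]
  calc (t : R) * X * ((u⁻¹ : Rˣ) : R) * ((u : R) * ((t⁻¹ : Rˣ) : R))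
      = (t : R) * X * (((u⁻¹ : Rˣ) : R) * (u : R)) * ((t⁻¹ : Rˣ) : R) := by simp only [mul_assoc]
    _ = X * (t : R) * ((t⁻¹ : Rˣ) : R) := by rw [Units.inv_mul, mul_one, htX.eq]
    _ = X := Units.mul_inv_cancel_right X t

end CayleyInv

section FormAdjoint

variable {E : Type*} [Field E] {n : Type*} [Fintype n] [DecidableEq n] (σ : E →+* E) {J : Matrix n n E}

/-- **The Cayley transform of a unitary element is θ-skew**: for `g ∈ U(σ, J)` with `1 + g` a unit, `θ_J c(g) = c(θ_J g) = c(g⁻¹) = −c(g)`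
(★ `antiHom_cayley`, ★ `formAdjoint_coe_eq_coe_inv`, §1). [cite: Weyl1939, Ch. II §10] -/
theorem formAdjoint_cayley_of_mem (hJ : IsUnit J.det) {g : GL n E} (hg : g ∈ unitaryGroupOfForm σ J) (h1 : IsUnit (1 + (g : Matrix n n E))) :
    J⁻¹ * ((cayley (g : Matrix n n E)).map σ)ᵀ * J = -cayley (g : Matrix n n E) := by
  have h := antiHom_cayley (fun Y : Matrix n n E => J⁻¹ * (Y.map σ)ᵀ * J) (formAdjoint_mul σ hJ) (formAdjoint_one σ hJ) (formAdjoint_add σ)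
    (formAdjoint_sub σ) h1
  rw [h, formAdjoint_coe_eq_coe_inv σ hJ hg, ← Ring.inverse_unit, cayley_ringInverse_eq_neg (Units.isUnit g) h1]

end FormAdjoint

/-! ## §2 Group coordinates on the slice factor: `ζ(Y) = γ c(Y) : B → Z_U(γ)` is an open partial homeomorphism at `b₀` -/

section GroupCoordinate

variable {E : Type*} [NontriviallyNormedField E] [CompleteSpace E] {n : Type*} [Fintype n] [DecidableEq n]
  {A : Type*} [TopologicalSpace A]

/-- **GROUP COORDINATES ON THE SLICE FACTOR.** For `γ ∈ U = U(σ, J)` and the slice data of part I — `τ : B → U`, `τ(Y) = γ c(Y) ∈ Z_U(γ)` on the θ-skew unit ball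
`B` of `𝔤_γ = ker ad γ`, `e : A × B → U` an open partial homeomorphism with `(a₀, b₀) ∈ e.source` — there are an open `B₀ ∋ b₀` with `{a₀} × B₀ ⊆ e.source` and
`ζ : OpenPartialHomeomorph B ↥(Z_U(γ))`, `ζ.source = B₀`, `↑(ζ b) = τ b`: its inverse is `m ↦ c(γ⁻¹ m)` (`c` is an involution, ★ `cayley_cayley`; `c(γ⁻¹ m) ∈ 𝔤_γ` by
★ `commute_cayley`, θ-skew by `formAdjoint_cayley_of_mem`), defined where `1 + γ⁻¹ m` is a unit and `‖c(γ⁻¹ m)‖ < 1` — an open neighbourhood of `γ` in `Z_U(γ)`.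
[cite: Weyl1939, Ch. II §10] [cite: HarishChandra1970, Part II §5] -/
theorem exists_openPartialHomeomorph_sliceGroupCoordinate [CharZero E] (σ : E →+* E) {J : Matrix n n E} (hJ : IsUnit J.det)
    (γ : ↥(unitaryGroupOfForm σ J))
    (τ : ↥{Y : Matrix n n E | Y ∈ LinearMap.ker (LinearMap.mulLeft E ((γ : GL n E) : Matrix n n E) -
            LinearMap.mulRight E ((γ : GL n E) : Matrix n n E)) ∧ J⁻¹ * (Y.map σ)ᵀ * J = -Y ∧ ‖Y‖ < 1} → ↥(unitaryGroupOfForm σ J))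
    (hτval : ∀ b, (((τ b : ↥(unitaryGroupOfForm σ J)) : GL n E) : Matrix n n E) = ((γ : GL n E) : Matrix n n E) * cayley (b : Matrix n n E))
    (hτ : Continuous τ) (hcomm : ∀ b, τ b ∈ Subgroup.centralizer ({γ} : Set ↥(unitaryGroupOfForm σ J)))
    (e : OpenPartialHomeomorph (A × ↥{Y : Matrix n n E | Y ∈ LinearMap.ker (LinearMap.mulLeft E ((γ : GL n E) : Matrix n n E) -
            LinearMap.mulRight E ((γ : GL n E) : Matrix n n E)) ∧ J⁻¹ * (Y.map σ)ᵀ * J = -Y ∧ ‖Y‖ < 1}) ↥(unitaryGroupOfForm σ J))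
    (a₀ : A) (b₀ : ↥{Y : Matrix n n E | Y ∈ LinearMap.ker (LinearMap.mulLeft E ((γ : GL n E) : Matrix n n E) -
            LinearMap.mulRight E ((γ : GL n E) : Matrix n n E)) ∧ J⁻¹ * (Y.map σ)ᵀ * J = -Y ∧ ‖Y‖ < 1}) (h₀ : (a₀, b₀) ∈ e.source) :
    ∃ (B₀ : Set ↥{Y : Matrix n n E | Y ∈ LinearMap.ker (LinearMap.mulLeft E ((γ : GL n E) : Matrix n n E) -
            LinearMap.mulRight E ((γ : GL n E) : Matrix n n E)) ∧ J⁻¹ * (Y.map σ)ᵀ * J = -Y ∧ ‖Y‖ < 1})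
      (ζ : OpenPartialHomeomorph ↥{Y : Matrix n n E | Y ∈ LinearMap.ker (LinearMap.mulLeft E ((γ : GL n E) : Matrix n n E) -
            LinearMap.mulRight E ((γ : GL n E) : Matrix n n E)) ∧ J⁻¹ * (Y.map σ)ᵀ * J = -Y ∧ ‖Y‖ < 1}
        ↥(Subgroup.centralizer ({γ} : Set ↥(unitaryGroupOfForm σ J)))),
      IsOpen B₀ ∧ b₀ ∈ B₀ ∧ (∀ b ∈ B₀, (a₀, b) ∈ e.source) ∧ ζ.source = B₀ ∧
      ∀ b, ((ζ b : ↥(Subgroup.centralizer ({γ} : Set ↥(unitaryGroupOfForm σ J)))) : ↥(unitaryGroupOfForm σ J)) = τ b := by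
  classical
  haveI : CompleteSpace (Matrix n n E) := FiniteDimensional.complete E (Matrix n n E)
  haveI : HasSummableGeomSeries (Matrix n n E) :=
    @instHasSummableGeomSeriesOfCompleteSpace (Matrix n n E) _ (FiniteDimensional.complete E (Matrix n n E))
  have h2M : IsUnit (2 : Matrix n n E) := by
    have h : algebraMap E (Matrix n n E) 2 = 2 := map_ofNat _ 2
    rw [← h]
    exact (IsUnit.mk0 (2 : E) two_ne_zero).map _
  -- `1 + Y` is a unit on the unit ball
  have h1S : ∀ {X : Matrix n n E}, ‖X‖ < 1 → IsUnit (1 + X) := fun {X} h => by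
    have hu := (Units.oneSub (-X) (by rwa [norm_neg])).isUnit
    rwa [Units.val_oneSub, sub_neg_eq_add] at hu
  -- the matrix of `γ⁻¹ m` and its Cayley transform
  let M : ↥(Subgroup.centralizer ({γ} : Set ↥(unitaryGroupOfForm σ J))) → Matrix n n E := fun m => (((γ⁻¹ * (m : ↥(unitaryGroupOfForm σ J)) : ↥(unitaryGroupOfForm σ J)) : GL n E) : Matrix n n E)
  let X : ↥(Subgroup.centralizer ({γ} : Set ↥(unitaryGroupOfForm σ J))) → Matrix n n E := fun m => cayley (M m)
  have hcoe : Continuous fun u : ↥(unitaryGroupOfForm σ J) => ((u : GL n E) : Matrix n n E) := Units.continuous_val.comp continuous_subtype_val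
  have hMc : Continuous M := hcoe.comp ((continuous_const.mul continuous_subtype_val))
  have hO : IsOpen {m : ↥(Subgroup.centralizer ({γ} : Set ↥(unitaryGroupOfForm σ J))) | IsUnit (1 + M m)} := Units.isOpen.preimage (continuous_const.add hMc)
  have hXc : ContinuousOn X {m : ↥(Subgroup.centralizer ({γ} : Set ↥(unitaryGroupOfForm σ J))) | IsUnit (1 + M m)} := fun m hm => by
    have hinv : ContinuousAt Ring.inverse (1 + M m) := by
      have h := NormedRing.inverse_continuousAt hm.unit
      rwa [hm.unit_spec] at h
    have hg : ContinuousAt (fun m' : ↥(Subgroup.centralizer ({γ} : Set ↥(unitaryGroupOfForm σ J))) => (1 : Matrix n n E) + M m') m := (continuous_const.add hMc).continuousAt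
    have h : ContinuousAt (fun m : ↥(Subgroup.centralizer ({γ} : Set ↥(unitaryGroupOfForm σ J))) => (1 - M m) * Ring.inverse (1 + M m)) m :=
      (continuous_const.sub hMc).continuousAt.mul (ContinuousAt.comp (f := fun m' => (1 : Matrix n n E) + M m') hinv hg)
    exact h.continuousWithinAt
  -- `X m` lies in the carrier on `{1 + γ⁻¹ m unit} ∩ {‖X m‖ < 1}`
  have hXSB : ∀ m : ↥(Subgroup.centralizer ({γ} : Set ↥(unitaryGroupOfForm σ J))), IsUnit (1 + M m) → ‖X m‖ < 1 → X m ∈ {Y : Matrix n n E | Y ∈ LinearMap.ker (LinearMap.mulLeft E ((γ : GL n E) : Matrix n n E) - LinearMap.mulRight E ((γ : GL n E) : Matrix n n E)) ∧ J⁻¹ * (Y.map σ)ᵀ * J = -Y ∧ ‖Y‖ < 1} := fun m hm hn => by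
    have hγm : Commute ((γ : GL n E) : Matrix n n E) (M m) := by
      have h := (Subgroup.mem_centralizer_singleton_iff.1 m.2)
      have h' : (γ : ↥(unitaryGroupOfForm σ J)) * (γ⁻¹ * (m : ↥(unitaryGroupOfForm σ J))) = (γ⁻¹ * (m : ↥(unitaryGroupOfForm σ J))) * γ := by
        rw [← mul_assoc, mul_inv_cancel, one_mul, mul_assoc, h, ← mul_assoc, inv_mul_cancel, one_mul]
      have h'' := congrArg (fun g : ↥(unitaryGroupOfForm σ J) => ((g : GL n E) : Matrix n n E)) h'
      simp only [Subgroup.coe_mul, Units.val_mul] at h''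
      show ((γ : GL n E) : Matrix n n E) * M m = M m * ((γ : GL n E) : Matrix n n E)
      simp only [M, Subgroup.coe_mul, Units.val_mul]
      exact h''
    have hker : X m ∈ LinearMap.ker (LinearMap.mulLeft E ((γ : GL n E) : Matrix n n E) - LinearMap.mulRight E ((γ : GL n E) : Matrix n n E)) := by
      rw [LinearMap.mem_ker, LinearMap.sub_apply, LinearMap.mulLeft_apply, LinearMap.mulRight_apply, sub_eq_zero]
      exact (commute_cayley hγm hm).eq
    exact ⟨hker, formAdjoint_cayley_of_mem σ hJ (γ⁻¹ * (m : ↥(unitaryGroupOfForm σ J))).2 hm, hn⟩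
  -- the total backward projection
  let prB : Matrix n n E → ↥{Y : Matrix n n E | Y ∈ LinearMap.ker (LinearMap.mulLeft E ((γ : GL n E) : Matrix n n E) - LinearMap.mulRight E ((γ : GL n E) : Matrix n n E)) ∧ J⁻¹ * (Y.map σ)ᵀ * J = -Y ∧ ‖Y‖ < 1} := fun Y => if h : Y ∈ {Y : Matrix n n E | Y ∈ LinearMap.ker (LinearMap.mulLeft E ((γ : GL n E) : Matrix n n E) - LinearMap.mulRight E ((γ : GL n E) : Matrix n n E)) ∧ J⁻¹ * (Y.map σ)ᵀ * J = -Y ∧ ‖Y‖ < 1} then ⟨Y, h⟩ else b₀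
  have hB₀o : IsOpen {b : ↥{Y : Matrix n n E | Y ∈ LinearMap.ker (LinearMap.mulLeft E ((γ : GL n E) : Matrix n n E) - LinearMap.mulRight E ((γ : GL n E) : Matrix n n E)) ∧ J⁻¹ * (Y.map σ)ᵀ * J = -Y ∧ ‖Y‖ < 1} | (a₀, b) ∈ e.source} := e.open_source.preimage (Continuous.prodMk_right a₀)
  have hO₂ : IsOpen {m : ↥(Subgroup.centralizer ({γ} : Set ↥(unitaryGroupOfForm σ J))) | IsUnit (1 + M m) ∧ ‖X m‖ < 1} := by
    have h := hXc.isOpen_inter_preimage hO (Metric.isOpen_ball (x := (0 : Matrix n n E)) (ε := 1))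
    have heq : {m : ↥(Subgroup.centralizer ({γ} : Set ↥(unitaryGroupOfForm σ J))) | IsUnit (1 + M m)} ∩ X ⁻¹' Metric.ball 0 1 = {m : ↥(Subgroup.centralizer ({γ} : Set ↥(unitaryGroupOfForm σ J))) | IsUnit (1 + M m) ∧ ‖X m‖ < 1} := by
      ext m; simp only [mem_inter_iff, mem_setOf_eq, mem_preimage, Metric.mem_ball, dist_zero_right]
    rwa [heq] at h
  have hprBX : ContinuousOn (fun m : ↥(Subgroup.centralizer ({γ} : Set ↥(unitaryGroupOfForm σ J))) => prB (X m)) {m : ↥(Subgroup.centralizer ({γ} : Set ↥(unitaryGroupOfForm σ J))) | IsUnit (1 + M m) ∧ ‖X m‖ < 1} := by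
    rw [Topology.IsInducing.subtypeVal.continuousOn_iff]
    refine (hXc.mono fun m hm => hm.1).congr fun m hm => ?_
    show ((prB (X m) : ↥{Y : Matrix n n E | Y ∈ LinearMap.ker (LinearMap.mulLeft E ((γ : GL n E) : Matrix n n E) - LinearMap.mulRight E ((γ : GL n E) : Matrix n n E)) ∧ J⁻¹ * (Y.map σ)ᵀ * J = -Y ∧ ‖Y‖ < 1}) : Matrix n n E) = X m
    simp only [prB, dif_pos (hXSB m hm.1 hm.2)]
  have hTgo : IsOpen {m : ↥(Subgroup.centralizer ({γ} : Set ↥(unitaryGroupOfForm σ J))) | IsUnit (1 + M m) ∧ ‖X m‖ < 1 ∧ (a₀, prB (X m)) ∈ e.source} := by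
    have h := hprBX.isOpen_inter_preimage hO₂ hB₀o
    have heq : {m : ↥(Subgroup.centralizer ({γ} : Set ↥(unitaryGroupOfForm σ J))) | IsUnit (1 + M m) ∧ ‖X m‖ < 1} ∩ (fun m : ↥(Subgroup.centralizer ({γ} : Set ↥(unitaryGroupOfForm σ J))) => prB (X m)) ⁻¹' {b : ↥{Y : Matrix n n E | Y ∈ LinearMap.ker (LinearMap.mulLeft E ((γ : GL n E) : Matrix n n E) - LinearMap.mulRight E ((γ : GL n E) : Matrix n n E)) ∧ J⁻¹ * (Y.map σ)ᵀ * J = -Y ∧ ‖Y‖ < 1} | (a₀, b) ∈ e.source} =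
        {m : ↥(Subgroup.centralizer ({γ} : Set ↥(unitaryGroupOfForm σ J))) | IsUnit (1 + M m) ∧ ‖X m‖ < 1 ∧ (a₀, prB (X m)) ∈ e.source} := by
      ext m; simp only [mem_inter_iff, mem_setOf_eq, mem_preimage, and_assoc]
    rwa [heq] at h
  -- the values of `M`, `X` on `τ b`
  have hMτ : ∀ b : ↥{Y : Matrix n n E | Y ∈ LinearMap.ker (LinearMap.mulLeft E ((γ : GL n E) : Matrix n n E) - LinearMap.mulRight E ((γ : GL n E) : Matrix n n E)) ∧ J⁻¹ * (Y.map σ)ᵀ * J = -Y ∧ ‖Y‖ < 1}, M ⟨τ b, hcomm b⟩ = cayley (b : Matrix n n E) := fun b => by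
    show (((γ⁻¹ * τ b : ↥(unitaryGroupOfForm σ J)) : GL n E) : Matrix n n E) = cayley (b : Matrix n n E)
    rw [Subgroup.coe_mul, Units.val_mul, hτval, ← Matrix.mul_assoc, Subgroup.coe_inv, ← Units.val_mul, inv_mul_cancel, Units.val_one,
      Matrix.one_mul]
  have hXτ : ∀ b : ↥{Y : Matrix n n E | Y ∈ LinearMap.ker (LinearMap.mulLeft E ((γ : GL n E) : Matrix n n E) - LinearMap.mulRight E ((γ : GL n E) : Matrix n n E)) ∧ J⁻¹ * (Y.map σ)ᵀ * J = -Y ∧ ‖Y‖ < 1}, X ⟨τ b, hcomm b⟩ = (b : Matrix n n E) := fun b => by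
    show cayley (M ⟨τ b, hcomm b⟩) = _
    rw [hMτ, cayley_cayley_of_isUnit_two h2M (h1S b.2.2.2)]
  have hprBb : ∀ b : ↥{Y : Matrix n n E | Y ∈ LinearMap.ker (LinearMap.mulLeft E ((γ : GL n E) : Matrix n n E) - LinearMap.mulRight E ((γ : GL n E) : Matrix n n E)) ∧ J⁻¹ * (Y.map σ)ᵀ * J = -Y ∧ ‖Y‖ < 1}, prB (b : Matrix n n E) = b := fun b => by simp only [prB, dif_pos b.2]
  refine ⟨{b : ↥{Y : Matrix n n E | Y ∈ LinearMap.ker (LinearMap.mulLeft E ((γ : GL n E) : Matrix n n E) - LinearMap.mulRight E ((γ : GL n E) : Matrix n n E)) ∧ J⁻¹ * (Y.map σ)ᵀ * J = -Y ∧ ‖Y‖ < 1} | (a₀, b) ∈ e.source},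
    { toFun := fun b => ⟨τ b, hcomm b⟩
      invFun := fun m => prB (X m)
      source := {b : ↥{Y : Matrix n n E | Y ∈ LinearMap.ker (LinearMap.mulLeft E ((γ : GL n E) : Matrix n n E) - LinearMap.mulRight E ((γ : GL n E) : Matrix n n E)) ∧ J⁻¹ * (Y.map σ)ᵀ * J = -Y ∧ ‖Y‖ < 1} | (a₀, b) ∈ e.source}
      target := {m : ↥(Subgroup.centralizer ({γ} : Set ↥(unitaryGroupOfForm σ J))) | IsUnit (1 + M m) ∧ ‖X m‖ < 1 ∧ (a₀, prB (X m)) ∈ e.source}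
      map_source' := ?_
      map_target' := fun m hm => hm.2.2
      left_inv' := ?_
      right_inv' := ?_
      open_source := hB₀o
      open_target := hTgo
      continuousOn_toFun := (hτ.subtype_mk _).continuousOn
      continuousOn_invFun := hprBX.mono fun m hm => ⟨hm.1, hm.2.1⟩ }, hB₀o, h₀, fun b hb => hb, rfl, fun b => rfl⟩
  · -- map_source
    intro b hb
    refine ⟨?_, ?_, ?_⟩
    · show IsUnit (1 + M ⟨τ b, hcomm b⟩)
      rw [hMτ]
      exact isUnit_one_add_cayley_of_isUnit_two h2M (h1S b.2.2.2)
    · show ‖X ⟨τ b, hcomm b⟩‖ < 1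
      rw [hXτ]
      exact b.2.2.2
    · show (a₀, prB (X ⟨τ b, hcomm b⟩)) ∈ e.source
      rw [hXτ, hprBb]
      exact hb
  · -- left_inv
    intro b hb
    show prB (X ⟨τ b, hcomm b⟩) = b
    rw [hXτ, hprBb]
  · -- right_inv
    intro m hm
    have hSBm : X m ∈ {Y : Matrix n n E | Y ∈ LinearMap.ker (LinearMap.mulLeft E ((γ : GL n E) : Matrix n n E) - LinearMap.mulRight E ((γ : GL n E) : Matrix n n E)) ∧ J⁻¹ * (Y.map σ)ᵀ * J = -Y ∧ ‖Y‖ < 1} := hXSB m hm.1 hm.2.1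
    have hpr : prB (X m) = ⟨X m, hSBm⟩ := by simp only [prB, dif_pos hSBm]
    apply Subtype.ext
    apply Subtype.ext
    apply Units.ext
    show (((τ (prB (X m)) : ↥(unitaryGroupOfForm σ J)) : GL n E) : Matrix n n E) = (((m : ↥(unitaryGroupOfForm σ J)) : GL n E) : Matrix n n E)
    rw [hτval, hpr]
    show ((γ : GL n E) : Matrix n n E) * cayley (cayley (M m)) = _
    rw [cayley_cayley_of_isUnit_two h2M hm.1]
    show ((γ : GL n E) : Matrix n n E) * (((γ⁻¹ * (m : ↥(unitaryGroupOfForm σ J)) : ↥(unitaryGroupOfForm σ J)) : GL n E) : Matrix n n E) = _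
    rw [Subgroup.coe_mul, Units.val_mul, ← Matrix.mul_assoc, Subgroup.coe_inv, ← Units.val_mul, mul_inv_cancel, Units.val_one, Matrix.one_mul]

end GroupCoordinate

end Literature.NumberTheory.Automorphic
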